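import Mathlib
import Literature.Analysis.FluidPDE.SelfSimilar
import Literature.Analysis.FluidPDE.TypeIAncientMild
import Literature.Analysis.FluidPDE.VectorCalculus
import Summits.NavierStokesRegularity.NavierStokesRegularity.Theorems.DssFarFieldSlavingBlowupTypeIDssProfileSmoothRepresentativeAe
import Summits.NavierStokesRegularity.NavierStokesRegularity.Theorems.DssFarFieldSlavingBlowupTypeIDssProfileSubcriticalStrain
import HarnessLib

/-!
# Explicit amplitude / strain / alignment thresholds for Type-I ancient mild solutions (theory T31″ / T31‴ / T31⁗ / T32 / T33) — STATEMENTS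

CONDITIONAL on the DERIVED, informal T31″/T31‴ (theory g4 2026-08-22; LIOUVILLE-SIDE v3.x §8); h is NOT
proved in this tree; this file is NOT a theorem about the class until h is; presearch status: NOT IN PRINT as
searched (cell lit seat g5, LIT-COVERAGE §18/§18.4, 2026-08-22: every printed small-Type-I-constant Liouville
statement is existential — Chae–Wolf 2017 Rmk 1.4, Chae–Kang–Lee 2009 Prop 2, KNSS 2009 p. 4
[cite: ChaeWolf2017RemovingDSS, Remark 1.4 (arXiv:1610.09464 p. 3)] [cite: ChaeKangLee2009, Rmk. 1 and Prop. 2]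
[cite: KochNadirashviliSereginSverak2009, §1 p. 4 (arXiv:0709.3599)]; the forward/Euler form of the STRAIN threshold is
printed — Chae, J. Funct. Anal. 258 (2010) Thm 1.1 [cite: Chae2010, Thm. 1.1 (arXiv:0711.1113 pp. 3–4)] with Chae–Kang–Lee,
DCDS 25 (2009) Rmk 1 — and its ancient form T32 was derived independently by the lit and theory seats). The same
sentence governs every later wrapper in this file (T31⁗ time-only form, T32 strain form, T33 alignment form, …;
pinned texts: HOME/LIOUVILLE-SIDE.md §8, theory/EXPLICIT-THRESHOLDS.md, lead ruling A115). Red-team ×2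
re-derivation of the hypotheses h: PASS — red g12, 2026-08-22T19:32:12Z, on the whole bundle T31″/T31‴/T31⁗/C31/T32/T32′/C32/T33/T33′/T34 (theory/EXPLICIT-THRESHOLDS.md v1.4 076c40b2c4c03eda; redteam/FINDINGS.md gen-12: every constant re-derived independently; scope notes R-51–R-53, none retracting: R-52 — where the blow-up corollary C31 is named, its hypothesis reads «bounded MILD (Oseen-gauge) solution on each [0,T′]»; R-53 — T31″ is a two-line combination of printed steps (Serrin-(2,∞) vorticity Grönwall + Type-I enstrophy scaling), DERIVED and not in print as searched, never a «new mechanism»; T31⁗'s Caccioppoli cut-off (no spatial hypothesis) is the only item beyond print); lead A117 (2026-08-22T19:34:59Z) cleared this landing. — EXCEPT the strain form: the hypothesis h of `rdssClass_subcriticalStrain_empty` (T32) IS discharged in this tree, `SubcriticalStrain.typeI_ancient_subcriticalStrain_eq_zero` / unconditional `SubcriticalStrain.rdssClass_subcriticalStrain_empty` (companion file, same cell), from route SymmetryModuliCount's `stretchCert_curl_eq_zero` (lead A119). (Note: the blow-up corollary C31 named above is, for classical Leray–Hopf solutions from rapidly decaying data, already implied by the tree's closed crux `Theses.TypeICertificateLadder.RungReynoldsOne`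 / `RungReynoldsOne_holds` — eventual √(T−t)‖u‖ ≤ √ν ⇒ smooth extension — by a different proof; the ANCIENT forms T31″/T31⁗ are not implied by it.)

HONEST FRAMING. This file TYPES two Liouville statements with EXPLICIT constants that the theory
seat DERIVED on paper (pub-ns-dss LIOUVILLE-SIDE §8 T31″, T31‴; MECHANISMS N3′(a″), (a‴)); their
proofs are NOT formalised here: the similarity-variables vorticity equation (`IsTypeIAncientMild.lerayVorticity_eq`),
the Gaussian-weighted Green/transport identities (`AncientSimilarityVorticity`) and a whole-space weak maximum
principle with linear drift (`le_of_subsolution_linear_drift`, route SymmetryModuliCount) ARE in the tree; what is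
missing for T31″/T31‴/T31⁗ is the whole-space energy bookkeeping (cut-off / decay) — lit g5 inventory 2026-08-22;
the strain form T32 IS formalised, see the EXCEPTION sentence above. They appear here only as HYPOTHESES `h` of the two theorems (spelled out inline — no new
`Prop` constant, no new obligation); the theorems say what they give at CLASS level for the hypothesis class of
`Theses.FilamentSkeletonRss.RdssProfileTruncation` — the class is empty for every Type-I constant
`M < 1` (resp. `M ≤ ½`) *conditionally on* T31″ (resp. T31‴). Level (lead A22): class, DERIVED-conditional.
Nothing here is a summit claim, and the tree's unconditional statement remains the existential
`ChaeWolf.exists_eps_typeI_small_eq_zero` / `ancient_typeI_smallConstant_eq_zero` (some `ε₀ > 0`).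

The paper argument (for the record; `U(y,s) = √(−t) u(x,t)`, `y = x/√(−t)`, `s = −log(−t)`,
`Ω = curl U`): `∂ₛΩ = ΔΩ − ½ y·∇Ω − Ω + (Ω·∇)U − (U·∇)Ω`; Type-I decay in space-time makes
`Ω(s), ∇Ω(s) ∈ L²(ℝ³)` uniformly in `s`, and the UNWEIGHTED pairing gives
`d/ds ½‖Ω‖² = −‖∇Ω‖² − ¼‖Ω‖² + ∫ ΩᵢΩⱼ∂ᵢUⱼ` (the steady case is Pineau–Vicol's enstrophy identity);
integrating the stretching term by parts, `∫ ΩᵢΩⱼ∂ᵢUⱼ = −∫ U·((Ω·∇)Ω) ≤ sup|U|·‖Ω‖‖∇Ω‖`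
(resp. `≤ 2·sup(|y||U|)·‖∇Ω‖²` by Hardy's inequality), whence `Ω ≡ 0` as soon as
`sup √(−t)‖u‖ < 1` (resp. `sup ‖x‖‖u‖ ≤ ½`). T31⁗ removes the spatial hypothesis from the time
form: with a radial cut-off `φ_R` the same pairing gives `d/ds Z_R ≤ −½(1−M_t²) Z_R + E_R` with
`E_R ≲ (R⁻² + R⁻¹) ∫_{R<|y|<2R} |Ω|²` (the drift's cut-off term has the good sign), and a four-step
bootstrap `sup_s ∫_{B_R}|Ω|² ≲ R³ → R² → R → 1 → R⁻¹` forces `Ω ≡ 0` using only the KNSS bounds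
`|Ω|, |∇Ω| ≤ C(M_t)` of bounded ancient mild solutions. T32 is the strain form: `|ω|²` is a
subsolution of `∂_t W ≤ ΔW − u·∇W + 2λ_max(S) W`, so `sup|ω(t)| ≤ sup|ω(t₀)| ((−t₀)/(−t))^Λ` with
`Λ = sup (−t) λ_max(S)`, and the Type-I bound `sup|ω(t₀)| ≲ (−t₀)⁻¹` gives `ω ≡ 0` when `Λ < 1`. The forward
(blow-up) form of this strain threshold is printed for Euler: Chae, J. Funct. Anal. 258 (2010),
Thm 1.1 (arXiv:0711.1113), with Chae–Kang–Lee, DCDS 25 (2009), Rmk 1 (gradient → strain); the ancient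
form T32 was derived independently by the cell's lit and theory seats (DERIVED, not in print as searched).
T33 is the Lamb-vector floor: Duhamel for the vorticity equation (no pressure) with the explicit heat
kernel constant `‖∇G_σ‖_{L¹} = (2/√π) σ^{-1/2}` gives `sup|Ω| ≤ (4/√π) sup|Ω × U|` and
`sup|Ω| ≤ sup|curl(Ω × U)|`; its endpoint is the threshold-free generalised-Beltrami cell E25. [cite: PineauVicol2026, Prop. 3.1 and (3.3)–(3.4) (arXiv:2607.09619 pp. 10–11)]
-/

set_option linter.dupNamespace false

namespace Summit.NavierStokesRegularity.NavierStokesRegularity.Theorems.ExplicitThreshold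

open MeasureTheory Set Literature.Analysis.FluidPDE
open Summit.NavierStokesRegularity.NavierStokesRegularity.Theorems

/-- The space-time Type-I bound with constant `C₀` bounds the time-only constant by `C₀`:
`√(−t)‖V(t,x)‖ ≤ C₀`. [folklore] -/
theorem sqrt_mul_norm_le_of_hasTypeIDecay {C₀ : ℝ}
    {V : ℝ → EuclideanSpace ℝ (Fin 3) → EuclideanSpace ℝ (Fin 3)} (hV : HasTypeIDecay C₀ V)
    (t : ℝ) (ht : t < 0) (x : EuclideanSpace ℝ (Fin 3)) : Real.sqrt (-t) * ‖V t x‖ ≤ C₀ := by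
  have hC₀ : 0 ≤ C₀ := by simpa using (norm_nonneg _).trans (hV (-1) (by norm_num) 0)
  have hs : 0 < Real.sqrt (-t) := Real.sqrt_pos.2 (by linarith)
  have hden : 0 < ‖x‖ + Real.sqrt (-t) := add_pos_of_nonneg_of_pos (norm_nonneg _) hs
  calc Real.sqrt (-t) * ‖V t x‖ ≤ Real.sqrt (-t) * (C₀ / (‖x‖ + Real.sqrt (-t))) :=
        mul_le_mul_of_nonneg_left (hV t ht x) hs.le
    _ ≤ C₀ := by
        rw [mul_div_assoc', div_le_iff₀ hden]
        nlinarith [norm_nonneg x]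

/-- The space-time Type-I bound with constant `C₀` bounds the space-only constant by `C₀`:
`‖x‖‖V(t,x)‖ ≤ C₀`. [folklore] -/
theorem norm_mul_norm_le_of_hasTypeIDecay {C₀ : ℝ}
    {V : ℝ → EuclideanSpace ℝ (Fin 3) → EuclideanSpace ℝ (Fin 3)} (hV : HasTypeIDecay C₀ V)
    (t : ℝ) (ht : t < 0) (x : EuclideanSpace ℝ (Fin 3)) : ‖x‖ * ‖V t x‖ ≤ C₀ := by
  have hC₀ : 0 ≤ C₀ := by simpa using (norm_nonneg _).trans (hV (-1) (by norm_num) 0)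
  have hs : 0 < Real.sqrt (-t) := Real.sqrt_pos.2 (by linarith)
  have hden : 0 < ‖x‖ + Real.sqrt (-t) := add_pos_of_nonneg_of_pos (norm_nonneg _) hs
  calc ‖x‖ * ‖V t x‖ ≤ ‖x‖ * (C₀ / (‖x‖ + Real.sqrt (-t))) :=
        mul_le_mul_of_nonneg_left (hV t ht x) (norm_nonneg x)
    _ ≤ C₀ := by
        rw [mul_div_assoc', div_le_iff₀ hden]
        nlinarith [norm_nonneg x, hs.le]

/-- **E3′ at CLASS level, conditional on T31″.** Hypothesis `h` is T31″ VERBATIM (explicit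
time-only threshold for smooth Type-I ancient mild solutions: `√(−t)‖V‖ ≤ θ < 1 ⇒ V ≡ 0`; DERIVED
on paper by the theory seat, NOT a tree theorem, hence carried as a hypothesis). If it holds, then
the hypothesis class of `RdssProfileTruncation` (any factor `c > 1`, any twist `R`) is EMPTY for
every Type-I constant `M < 1`: the smooth representative (`typeI_ancient_smoothRepresentative_ae`)
has `√(−t)‖V‖ ≤ M < 1`, hence vanishes, hence every slice of `u` is a.e. zero. [this file] -/
theorem rdssClass_empty_of_explicitTimeThreshold
    (h : ∀ ⦃C₀ θ : ℝ⦄ ⦃V : ℝ → EuclideanSpace ℝ (Fin 3) → EuclideanSpace ℝ (Fin 3)⦄, θ < 1 →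
      IsTypeIAncientMild C₀ V → HasTypeIDecay C₀ V →
      (∀ t < 0, ∀ x, Real.sqrt (-t) * ‖V t x‖ ≤ θ) → ∀ t < 0, ∀ x, V t x = 0)
    {M : ℝ} (hM : M < 1) :
    ¬ ∃ (c : ℝ) (R : (EuclideanSpace ℝ (Fin 3)) ≃ₗᵢ[ℝ] (EuclideanSpace ℝ (Fin 3)))
        (u : ℝ → (EuclideanSpace ℝ (Fin 3)) → (EuclideanSpace ℝ (Fin 3))),
      1 < c ∧ IsAncientMildSolution 1 u ∧ (∀ t < 0, AEStronglyMeasurable (u t) volume) ∧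
      IsRotatedDSS c R u ∧ HasTypeIDecay M u ∧ ¬ (∀ t < 0, u t =ᵐ[volume] 0) := by
  rintro ⟨c, R, u, -, hmild, hmeas, -, hdec, hne⟩
  obtain ⟨V, hT, hdecV, hVu, -⟩ := typeI_ancient_smoothRepresentative_ae hmild hmeas hdec
  have hz : ∀ t < 0, ∀ x, V t x = 0 :=
    h hM hT hdecV fun t ht x => sqrt_mul_norm_le_of_hasTypeIDecay hdecV t ht x
  refine hne fun t ht => ?_
  have hVz : V t = 0 := funext fun x => by simpa using hz t ht x
  exact (hVu t ht).symm.trans (Filter.EventuallyEq.of_eq hVz)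

/-- **E3′ at CLASS level, conditional on T31⁗ (the time-only form WITHOUT any spatial hypothesis).**
Hypothesis `h` is T31⁗ verbatim over the tree's structure `IsTypeIAncientMild` (smooth, divergence
free, mild, `‖V(t,x)‖ ≤ C/√(−t)`): `C < 1 ⇒ V ≡ 0` (DERIVED on paper by a cut-off enstrophy
bootstrap in similarity variables; NOT a tree theorem). If it holds, the hypothesis class of
`RdssProfileTruncation` is empty for every Type-I constant `M < 1`. [this file] -/
theorem rdssClass_empty_of_timeOnlyThreshold
    (h : ∀ ⦃C : ℝ⦄ ⦃V : ℝ → EuclideanSpace ℝ (Fin 3) → EuclideanSpace ℝ (Fin 3)⦄, C < 1 →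
      IsTypeIAncientMild C V → ∀ t < 0, ∀ x, V t x = 0)
    {M : ℝ} (hM : M < 1) :
    ¬ ∃ (c : ℝ) (R : (EuclideanSpace ℝ (Fin 3)) ≃ₗᵢ[ℝ] (EuclideanSpace ℝ (Fin 3)))
        (u : ℝ → (EuclideanSpace ℝ (Fin 3)) → (EuclideanSpace ℝ (Fin 3))),
      1 < c ∧ IsAncientMildSolution 1 u ∧ (∀ t < 0, AEStronglyMeasurable (u t) volume) ∧
      IsRotatedDSS c R u ∧ HasTypeIDecay M u ∧ ¬ (∀ t < 0, u t =ᵐ[volume] 0) := by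
  rintro ⟨c, R, u, -, hmild, hmeas, -, hdec, hne⟩
  obtain ⟨V, hT, -, hVu, -⟩ := typeI_ancient_smoothRepresentative_ae hmild hmeas hdec
  have hz : ∀ t < 0, ∀ x, V t x = 0 := h hM hT
  refine hne fun t ht => ?_
  have hVz : V t = 0 := funext fun x => by simpa using hz t ht x
  exact (hVu t ht).symm.trans (Filter.EventuallyEq.of_eq hVz)

/-- **E3′ (space form) at CLASS level, conditional on T31‴** (hypothesis `h` = T31‴ verbatim:
`‖x‖‖V‖ ≤ ½ ⇒ V ≡ 0` for smooth Type-I ancient mild solutions; DERIVED, not a tree theorem): the class is empty for every Type-I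
constant `M ≤ ½`. (At fixed `M` this is implied by the time form; it is recorded because the
space-only constant of a state can be small while its time-only constant is not.) [this file] -/
theorem rdssClass_empty_of_explicitSpaceThreshold
    (h : ∀ ⦃C₀ : ℝ⦄ ⦃V : ℝ → EuclideanSpace ℝ (Fin 3) → EuclideanSpace ℝ (Fin 3)⦄,
      IsTypeIAncientMild C₀ V → HasTypeIDecay C₀ V →
      (∀ t < 0, ∀ x, ‖x‖ * ‖V t x‖ ≤ 1 / 2) → ∀ t < 0, ∀ x, V t x = 0)
    {M : ℝ} (hM : M ≤ 1 / 2) :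
    ¬ ∃ (c : ℝ) (R : (EuclideanSpace ℝ (Fin 3)) ≃ₗᵢ[ℝ] (EuclideanSpace ℝ (Fin 3)))
        (u : ℝ → (EuclideanSpace ℝ (Fin 3)) → (EuclideanSpace ℝ (Fin 3))),
      1 < c ∧ IsAncientMildSolution 1 u ∧ (∀ t < 0, AEStronglyMeasurable (u t) volume) ∧
      IsRotatedDSS c R u ∧ HasTypeIDecay M u ∧ ¬ (∀ t < 0, u t =ᵐ[volume] 0) := by
  rintro ⟨c, R, u, -, hmild, hmeas, -, hdec, hne⟩
  obtain ⟨V, hT, hdecV, hVu, -⟩ := typeI_ancient_smoothRepresentative_ae hmild hmeas hdec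
  have hz : ∀ t < 0, ∀ x, V t x = 0 :=
    h hT hdecV fun t ht x => (norm_mul_norm_le_of_hasTypeIDecay hdecV t ht x).trans hM
  refine hne fun t ht => ?_
  have hVz : V t = 0 := funext fun x => by simpa using hz t ht x
  exact (hVu t ht).symm.trans (Filter.EventuallyEq.of_eq hVz)

/-- **E24 at CLASS level, conditional on T32 (the STRAIN threshold).** Hypothesis `h` is T32
verbatim: a smooth ancient mild solution with a time-Type-I bound (any constant `C`) whose strain
satisfies `ξᵀ ∇V(t,x) ξ ≤ (Λ/(−t)) ‖ξ‖²` for all `ξ` (i.e. `(−t)·λ_max(S) ≤ Λ`; the quadratic form of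
`∇V` only sees the symmetric part `S`) with `Λ < 1` vanishes identically (DERIVED on paper: `|ω|²`
is a subsolution of the heat equation with drift `V` and potential `2 λ_max(S)`, so
`sup|ω(t)| ≤ sup|ω(t₀)| ((−t₀)/(−t))^Λ`, and the Type-I bound `sup|ω(t₀)| ≲ (−t₀)⁻¹` kills `ω` as
`t₀ → −∞`; NOT a tree theorem). If it holds, the SUB-CRITICAL-STRAIN cell of the hypothesis class of
`RdssProfileTruncation` is empty for every Type-I constant `M`: no member all of whose smooth
Type-I representatives have `(−t)·λ_max(S) ≤ Λ < 1` (representatives quantified as in the E23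
wrapper, since the class speaks about an a.e. object). [this file] -/
theorem rdssClass_subcriticalStrain_empty
    (h : ∀ ⦃C Λ : ℝ⦄ ⦃V : ℝ → EuclideanSpace ℝ (Fin 3) → EuclideanSpace ℝ (Fin 3)⦄, Λ < 1 →
      IsTypeIAncientMild C V →
      (∀ t < 0, ∀ x ξ : EuclideanSpace ℝ (Fin 3),
        inner ℝ (fderiv ℝ (V t) x ξ) ξ ≤ Λ / (-t) * ‖ξ‖ ^ 2) → ∀ t < 0, ∀ x, V t x = 0)
    (M : ℝ) {Λ : ℝ} (hΛ : Λ < 1) :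
    ¬ ∃ (c : ℝ) (R : (EuclideanSpace ℝ (Fin 3)) ≃ₗᵢ[ℝ] (EuclideanSpace ℝ (Fin 3)))
        (u : ℝ → (EuclideanSpace ℝ (Fin 3)) → (EuclideanSpace ℝ (Fin 3))),
      1 < c ∧ IsAncientMildSolution 1 u ∧ (∀ t < 0, AEStronglyMeasurable (u t) volume) ∧
      IsRotatedDSS c R u ∧ HasTypeIDecay M u ∧
      (∀ V : ℝ → EuclideanSpace ℝ (Fin 3) → EuclideanSpace ℝ (Fin 3), IsTypeIAncientMild M V →
        (∀ t < 0, V t =ᵐ[volume] u t) →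
        ∀ t < 0, ∀ x ξ : EuclideanSpace ℝ (Fin 3),
          inner ℝ (fderiv ℝ (V t) x ξ) ξ ≤ Λ / (-t) * ‖ξ‖ ^ 2) ∧
      ¬ (∀ t < 0, u t =ᵐ[volume] 0) := by
  rintro ⟨c, R, u, -, hmild, hmeas, -, hdec, hstrain, hne⟩
  obtain ⟨V, hT, -, hVu, -⟩ := typeI_ancient_smoothRepresentative_ae hmild hmeas hdec
  have hz : ∀ t < 0, ∀ x, V t x = 0 := h hΛ hT (hstrain V hT hVu)
  refine hne fun t ht => ?_
  have hVz : V t = 0 := funext fun x => by simpa using hz t ht x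
  exact (hVu t ht).symm.trans (Filter.EventuallyEq.of_eq hVz)

/-- **E25 at CLASS level, conditional on T33 (the generalised-Beltrami cell; THRESHOLD-FREE).**
Hypothesis `h` is the endpoint case of T33: a smooth ancient mild solution with a time-Type-I bound
whose Lamb vector `ω × V` is curl-free at every negative time (so the nonlinearity is a pure gradient
and `V` solves the heat equation modulo pressure) vanishes identically (DERIVED on paper by vorticity
Duhamel: `sup|Ω| ≤ sup|curl(Ω × U)| = 0`; NOT a tree theorem). If it holds, NO member of the hypothesis
class of `RdssProfileTruncation` — any Type-I constant, factor, isometry — has all its smooth Type-I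
representatives generalised-Beltrami (representatives quantified as in the E23/E24 wrappers).
`curl`, `cross` are the tree's (`Literature.Analysis.FluidPDE.VectorCalculus`). [this file] -/
theorem rdssClass_generalisedBeltrami_empty
    (h : ∀ ⦃C : ℝ⦄ ⦃V : ℝ → EuclideanSpace ℝ (Fin 3) → EuclideanSpace ℝ (Fin 3)⦄,
      IsTypeIAncientMild C V →
      (∀ t < 0, ∀ x, curl (fun y => cross (curl (V t) y) (V t y)) x = 0) →
      ∀ t < 0, ∀ x, V t x = 0)
    (M : ℝ) :
    ¬ ∃ (c : ℝ) (R : (EuclideanSpace ℝ (Fin 3)) ≃ₗᵢ[ℝ] (EuclideanSpace ℝ (Fin 3)))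
        (u : ℝ → (EuclideanSpace ℝ (Fin 3)) → (EuclideanSpace ℝ (Fin 3))),
      1 < c ∧ IsAncientMildSolution 1 u ∧ (∀ t < 0, AEStronglyMeasurable (u t) volume) ∧
      IsRotatedDSS c R u ∧ HasTypeIDecay M u ∧
      (∀ V : ℝ → EuclideanSpace ℝ (Fin 3) → EuclideanSpace ℝ (Fin 3), IsTypeIAncientMild M V →
        (∀ t < 0, V t =ᵐ[volume] u t) →
        ∀ t < 0, ∀ x, curl (fun y => cross (curl (V t) y) (V t y)) x = 0) ∧
      ¬ (∀ t < 0, u t =ᵐ[volume] 0) := by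
  rintro ⟨c, R, u, -, hmild, hmeas, -, hdec, hbel, hne⟩
  obtain ⟨V, hT, -, hVu, -⟩ := typeI_ancient_smoothRepresentative_ae hmild hmeas hdec
  have hz : ∀ t < 0, ∀ x, V t x = 0 := h hT (hbel V hT hVu)
  refine hne fun t ht => ?_
  have hVz : V t = 0 := funext fun x => by simpa using hz t ht x
  exact (hVu t ht).symm.trans (Filter.EventuallyEq.of_eq hVz)

/-- BRIDGE (pub-ns-dss theory seat g5, written after p340592 = `…Theorems.SubcriticalStrain` landed;
bookkeeping only). The hypothesis `h` of the CONDITIONAL wrapper `rdssClass_subcriticalStrain_empty`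
above (T32 in conditional form) is discharged in the tree by
`SubcriticalStrain.typeI_ancient_subcriticalStrain_eq_zero` (route SymmetryModuliCount's stretching
certificate at `h ≡ 1`, `A = 0`, `δ = 1 − Λ`). Consequently `rdssClass_subcriticalStrain_empty
subcriticalStrain_hypothesis_holds M hΛ` is an unconditional proof of the E24 class statement, token-identical
in content to `SubcriticalStrain.rdssClass_subcriticalStrain_empty M hΛ`; the conditional wrapper is therefore
SUPERSEDED and kept for the record only. The other wrappers of this file (T31″, T31⁗, T31‴, T33) remain
conditional: their hypotheses are red-×2-checked paper derivations, not tree theorems. Wildcard binders: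
the gate's unused-variable lint fires on named `C Λ V` here. -/
theorem subcriticalStrain_hypothesis_holds :
    ∀ ⦃C Λ : ℝ⦄ ⦃V : ℝ → EuclideanSpace ℝ (Fin 3) → EuclideanSpace ℝ (Fin 3)⦄, Λ < 1 →
      IsTypeIAncientMild C V →
      (∀ t < 0, ∀ x ξ : EuclideanSpace ℝ (Fin 3),
        inner ℝ (fderiv ℝ (V t) x ξ) ξ ≤ Λ / (-t) * ‖ξ‖ ^ 2) → ∀ t < 0, ∀ x, V t x = 0 :=
  fun _ _ _ hΛ hV hs => SubcriticalStrain.typeI_ancient_subcriticalStrain_eq_zero hΛ hV hs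

/-- E24 at class level, UNCONDITIONALLY, through this file's conditional wrapper and the bridge
(equals `SubcriticalStrain.rdssClass_subcriticalStrain_empty`; recorded to close the loop inside the
explicit-threshold file — census label «E24 PROVED IN TREE», cell pub-ns-dss). -/
theorem rdssClass_subcriticalStrain_empty_unconditional (M : ℝ) {Λ : ℝ} (hΛ : Λ < 1) :
    ¬ ∃ (c : ℝ) (R : (EuclideanSpace ℝ (Fin 3)) ≃ₗᵢ[ℝ] (EuclideanSpace ℝ (Fin 3)))
        (u : ℝ → (EuclideanSpace ℝ (Fin 3)) → (EuclideanSpace ℝ (Fin 3))),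
      1 < c ∧ IsAncientMildSolution 1 u ∧ (∀ t < 0, AEStronglyMeasurable (u t) volume) ∧
      IsRotatedDSS c R u ∧ HasTypeIDecay M u ∧
      (∀ V : ℝ → EuclideanSpace ℝ (Fin 3) → EuclideanSpace ℝ (Fin 3), IsTypeIAncientMild M V →
        (∀ t < 0, V t =ᵐ[volume] u t) →
        ∀ t < 0, ∀ x ξ : EuclideanSpace ℝ (Fin 3),
          inner ℝ (fderiv ℝ (V t) x ξ) ξ ≤ Λ / (-t) * ‖ξ‖ ^ 2) ∧
      ¬ (∀ t < 0, u t =ᵐ[volume] 0) :=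
  rdssClass_subcriticalStrain_empty subcriticalStrain_hypothesis_holds M hΛ

end Summit.NavierStokesRegularity.NavierStokesRegularity.Theorems.ExplicitThreshold
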